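import Mathlib

/-!
# Crux `HilbertIntegralOverconvergentIsCongruence` (stmt-Langlands-8485), line `Sketch-ideate-r1-k1`:
# stub S6 — the GAIN of the dimension-free algebraization engine

The gain step of the `d`-free algebraization engine with vector weights.  `V` is a `𝓦`-graded family
of `p`-adic multivariable power series with a sup-norm Sturm principle on the windows
`{ν : wt ν < L b}`, `G` a Katz sum `Σ_i a_i e^{-i}` with `a_i ∈ V (k + i • t)`, `‖a_i‖ ≤ C ρ^i`.
For the polynomial expression `F = Σ_u l_u • (f_u * G^{j_u})` with `f_u ∈ V (D • w₀ - j_u • k)`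
integral and `‖l_u‖ ≤ 1`, vanishing of `coeff_ν F` for `wt ν < n` forces
`‖coeff_ν F‖ ≤ (C·A)^D R^{-n}`.

The three inputs are hypotheses: the Katz-data algebra for a `𝓦`-graded family (`hS4`, stub S4),
the graded Katz–Sturm gain (`hS3`, stub S3) and the real arithmetic converting "gain below every
admissible affine Sturm line" into the exponential bound (`hconv`, the output of stub S5).  The proof
is plumbing: reindex the finite family along `U ≃ Fin (card U)` to feed `hS4`, obtain a Katz datum
`(A_i)` of weight `D • w₀` summing to `F`, run `hS3` below every Sturm line `L (D • w₀ + M • t) ≤ n`,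
and convert with `hconv`.

* `stub_mvGainBound` (registered stub S6).

Theorems only, no `sorry`.
-/

set_option linter.dupNamespace false

noncomputable section

namespace Summit.Langlands.Langlands.Theorems.HilbertIntegralOverconvergentIsCongruence

open MvPowerSeries in
/-- **stub S6 — `stub_mvGainBound` (M; R8b with the Sturm family a hypothesis).**  Over a nonarchimedean
normed field `K`, variables `σ`, weights `𝓦`: assume S4 (`hS4`, the Katz-data algebra) and S3 (`hS3`, the
graded gain) at `K, σ, 𝓦`.  Let `V` be a graded family of subspaces closed under products with the sup-norm
Sturm principle on the windows `{wt < L b}` (`wt` additive), the Sturm line affine along the rays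
`D • w₀ + M • t` (`hL`) with S5's output `hconv` for these constants; `e ∈ V t` an integral Hasse lift,
`(a_i)` a Katz datum of weight `k` (`a_i ∈ V (k + i • t)`, `‖a_i‖ ≤ C ρ^i`, `1 ≤ C`) summing to `G`.  Then
for `D ≥ 1`, finitely many exponents `j_u ≤ D`, integral `f_u ∈ V (D • w₀ - j_u • k)` and scalars
`‖l_u‖ ≤ 1`, the series `F = Σ_u l_u · f_u · G^{j_u}` satisfies: if `coeff_ν F = 0` whenever `wt ν < n`,
then `‖coeff_ν F‖ ≤ (C · A)^D · R^{-n}` for every `ν`. [folklore] -/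
theorem stub_mvGainBound {K σ 𝓦 U : Type*} [NormedField K] [IsUltrametricDist K] [AddCommGroup 𝓦]
    [Fintype U]
    (hS4 : ∀ {U' : Type} [Fintype U']
      (V : 𝓦 → Set (MvPowerSeries σ K)) (_ : (1 : MvPowerSeries σ K) ∈ V 0)
      (_ : ∀ b : 𝓦, (0 : MvPowerSeries σ K) ∈ V b)
      (_ : ∀ (b : 𝓦) (φ ψ : MvPowerSeries σ K), φ ∈ V b → ψ ∈ V b → φ + ψ ∈ V b)
      (_ : ∀ (b : 𝓦) (c : K) (φ : MvPowerSeries σ K), φ ∈ V b → c • φ ∈ V b)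
      (_ : ∀ (b₁ b₂ : 𝓦) (φ ψ : MvPowerSeries σ K), φ ∈ V b₁ → ψ ∈ V b₂ → φ * ψ ∈ V (b₁ + b₂))
      (e : MvPowerSeries σ K) (t : 𝓦) (_ : constantCoeff e = 1) (_ : ∀ n, ‖coeff n e‖ ≤ 1)
      (a : ℕ → MvPowerSeries σ K) (w : 𝓦) (_ : ∀ i : ℕ, a i ∈ V (w + i • t))
      (ρ C : ℝ) (_ : 0 ≤ ρ) (_ : ρ ≤ 1) (_ : 1 ≤ C) (_ : ∀ i n, ‖coeff n (a i)‖ ≤ C * ρ ^ i)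
      (G : MvPowerSeries σ K) (_ : ∀ n, HasSum (fun i : ℕ ↦ coeff n (a i * e⁻¹ ^ i)) (coeff n G))
      (D : ℕ) (j : U' → ℕ) (_ : ∀ u, j u ≤ D) (T : 𝓦)
      (f : U' → MvPowerSeries σ K) (_ : ∀ u, f u ∈ V (T - j u • w))
      (_ : ∀ u n, ‖coeff n (f u)‖ ≤ 1) (l : U' → K) (_ : ∀ u, ‖l u‖ ≤ 1),
      ∃ A : ℕ → MvPowerSeries σ K,
        (∀ i : ℕ, A i ∈ V (T + i • t)) ∧ (∀ i n, ‖coeff n (A i)‖ ≤ C ^ D * ρ ^ i) ∧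
        (∀ n, HasSum (fun i : ℕ ↦ coeff n (A i * e⁻¹ ^ i)) (coeff n (∑ u, l u • (f u * G ^ j u)))) ∧
        ∀ n, ‖coeff n (∑ u, l u • (f u * G ^ j u))‖ ≤ C ^ D)
    (hS3 : ∀ (V : 𝓦 → Set (MvPowerSeries σ K)) (_ : (1 : MvPowerSeries σ K) ∈ V 0)
      (_ : ∀ (b₁ b₂ : 𝓦) (φ ψ : MvPowerSeries σ K), φ ∈ V b₁ → ψ ∈ V b₂ → φ * ψ ∈ V (b₁ + b₂))
      (_ : ∀ (b : 𝓦) (s : Finset ℕ) (φ : ℕ → MvPowerSeries σ K),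
        (∀ i ∈ s, φ i ∈ V b) → (∑ i ∈ s, φ i) ∈ V b)
      (W : 𝓦 → Set (σ →₀ ℕ))
      (_ : ∀ (b : 𝓦), ∀ T ∈ V b, ∀ B : ℝ, 0 ≤ B → (∀ n ∈ W b, ‖coeff n T‖ ≤ B) →
        ∀ n, ‖coeff n T‖ ≤ B)
      (wt : (σ →₀ ℕ) → ℕ) (_ : Monotone wt) (L : 𝓦 → ℕ) (_ : ∀ b, ∀ n ∈ W b, wt n < L b)
      (e : MvPowerSeries σ K) (t : 𝓦) (_ : constantCoeff e = 1) (_ : ∀ n, ‖coeff n e‖ ≤ 1)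
      (_ : e ∈ V t)
      (a : ℕ → MvPowerSeries σ K) (w : 𝓦) (_ : ∀ i : ℕ, a i ∈ V (w + i • t))
      (ρ C : ℝ) (_ : 0 ≤ ρ) (_ : ρ ≤ 1) (_ : 0 ≤ C) (_ : ∀ i n, ‖coeff n (a i)‖ ≤ C * ρ ^ i)
      (G : MvPowerSeries σ K) (_ : ∀ n, HasSum (fun i : ℕ ↦ coeff n (a i * e⁻¹ ^ i)) (coeff n G))
      (m : ℕ) (_ : ∀ n, wt n < m → coeff n G = 0) (M : ℕ) (_ : L (w + M • t) ≤ m),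
      ∀ n, ‖coeff n G‖ ≤ C * ρ ^ (M + 1))
    (V : 𝓦 → Set (MvPowerSeries σ K)) (hV1 : (1 : MvPowerSeries σ K) ∈ V 0)
    (hV0 : ∀ b : 𝓦, (0 : MvPowerSeries σ K) ∈ V b)
    (hVadd : ∀ (b : 𝓦) (φ ψ : MvPowerSeries σ K), φ ∈ V b → ψ ∈ V b → φ + ψ ∈ V b)
    (hVsmul : ∀ (b : 𝓦) (c : K) (φ : MvPowerSeries σ K), φ ∈ V b → c • φ ∈ V b)
    (hVmul : ∀ (b₁ b₂ : 𝓦) (φ ψ : MvPowerSeries σ K), φ ∈ V b₁ → ψ ∈ V b₂ → φ * ψ ∈ V (b₁ + b₂))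
    (wt : (σ →₀ ℕ) →+ ℕ) (L : 𝓦 → ℕ)
    (hSturm : ∀ b, ∀ T ∈ V b, ∀ B : ℝ, 0 ≤ B →
      (∀ n, wt n < L b → ‖coeff n T‖ ≤ B) → ∀ n, ‖coeff n T‖ ≤ B)
    (e : MvPowerSeries σ K) (t : 𝓦) (he0 : constantCoeff e = 1) (he : ∀ n, ‖coeff n e‖ ≤ 1)
    (heV : e ∈ V t)
    (G : MvPowerSeries σ K) (k : 𝓦) (a : ℕ → MvPowerSeries σ K) (haV : ∀ i : ℕ, a i ∈ V (k + i • t))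
    (ρ C : ℝ) (hρ0 : 0 < ρ) (hρ1 : ρ < 1) (hC : 1 ≤ C) (ha : ∀ i n, ‖coeff n (a i)‖ ≤ C * ρ ^ i)
    (hG : ∀ n, HasSum (fun i : ℕ ↦ coeff n (a i * e⁻¹ ^ i)) (coeff n G))
    (w₀ : 𝓦) (c₀ ct c₁ : ℝ) (hL : ∀ D M : ℕ, (L (D • w₀ + M • t) : ℝ) ≤ c₀ * D + ct * M + c₁)
    (A R : ℝ)
    (hconv : ∀ (D n : ℕ) (x C' : ℝ), 1 ≤ D → 0 ≤ C' → x ≤ C' →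
      (∀ M : ℕ, c₀ * D + ct * M + c₁ ≤ n → x ≤ C' * ρ ^ (M + 1)) → x ≤ C' * A ^ D * R⁻¹ ^ n)
    (D : ℕ) (hD : 1 ≤ D) (jU : U → ℕ) (hjU : ∀ u, jU u ≤ D)
    (f : U → MvPowerSeries σ K) (hfV : ∀ u, f u ∈ V (D • w₀ - jU u • k))
    (hf1 : ∀ u n, ‖coeff n (f u)‖ ≤ 1) (l : U → K) (hl : ∀ u, ‖l u‖ ≤ 1)
    (n : ℕ) (hvan : ∀ ν, wt ν < n → coeff ν (∑ u, l u • (f u * G ^ jU u)) = 0) (ν : σ →₀ ℕ) :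
    ‖coeff ν (∑ u, l u • (f u * G ^ jU u))‖ ≤ (C * A) ^ D * R⁻¹ ^ n := by
  classical
  -- Step 1: the Katz datum of `F = Σ_u l_u • (f_u * G^{j_u})` (the Katz-data algebra `hS4`, after
  -- reindexing the finite family along `U ≃ Fin (card U)` to land in `Type`).
  obtain ⟨AK, hAKV, hAKnorm, hAKsum, hAKtriv⟩ :
      ∃ A' : ℕ → MvPowerSeries σ K,
        (∀ i : ℕ, A' i ∈ V (D • w₀ + i • t)) ∧ (∀ i n, ‖coeff n (A' i)‖ ≤ C ^ D * ρ ^ i) ∧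
        (∀ n, HasSum (fun i : ℕ ↦ coeff n (A' i * e⁻¹ ^ i))
          (coeff n (∑ u, l u • (f u * G ^ jU u)))) ∧
        ∀ n, ‖coeff n (∑ u, l u • (f u * G ^ jU u))‖ ≤ C ^ D := by
    have hsum : (∑ u' : Fin (Fintype.card U), l ((Fintype.equivFin U).symm u') •
        (f ((Fintype.equivFin U).symm u') * G ^ jU ((Fintype.equivFin U).symm u'))) =
        ∑ u, l u • (f u * G ^ jU u) :=
      Equiv.sum_comp (Fintype.equivFin U).symm (fun u ↦ l u • (f u * G ^ jU u))
    rw [← hsum]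
    exact hS4 V hV1 hV0 hVadd hVsmul hVmul e t he0 he a k haV ρ C hρ0.le hρ1.le hC ha G hG D
      (fun u' ↦ jU ((Fintype.equivFin U).symm u')) (fun u' ↦ hjU _) (D • w₀)
      (fun u' ↦ f ((Fintype.equivFin U).symm u')) (fun u' ↦ hfV _) (fun u' n ↦ hf1 _ n)
      (fun u' ↦ l ((Fintype.equivFin U).symm u')) (fun u' ↦ hl _)
  -- Step 2: the graded gain below every admissible Sturm line (`hS3` on the windows `{wt < L b}`).
  have hCD : (0 : ℝ) ≤ C ^ D := pow_nonneg (zero_le_one.trans hC) _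
  have hVsum : ∀ (b : 𝓦) (s : Finset ℕ) (φ : ℕ → MvPowerSeries σ K),
      (∀ i ∈ s, φ i ∈ V b) → (∑ i ∈ s, φ i) ∈ V b := fun b _ φ hφ ↦
    Finset.sum_induction φ (· ∈ V b) (fun x y hx hy ↦ hVadd b x y hx hy) (hV0 b) hφ
  have hmono : Monotone (⇑wt) := by
    intro x y hxy
    obtain ⟨z, rfl⟩ := exists_add_of_le hxy
    rw [map_add]
    exact Nat.le_add_right _ _
  have hgainM : ∀ M : ℕ, L (D • w₀ + M • t) ≤ n →
      ∀ nn, ‖coeff nn (∑ u, l u • (f u * G ^ jU u))‖ ≤ C ^ D * ρ ^ (M + 1) := fun M hM ↦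
    hS3 V hV1 hVmul hVsum (fun b ↦ {nn | wt nn < L b})
      (fun b T hT B hB h ↦ hSturm b T hT B hB (fun nn hnn ↦ h nn hnn)) (⇑wt) hmono L
      (fun _ _ hnn ↦ hnn) e t he0 he heV AK (D • w₀) hAKV ρ (C ^ D) hρ0.le hρ1.le hCD hAKnorm
      _ hAKsum n hvan M hM
  -- Step 3: the arithmetic of the gain at the coefficient `ν`.
  have hx : ‖coeff ν (∑ u, l u • (f u * G ^ jU u))‖ ≤ C ^ D * A ^ D * R⁻¹ ^ n := by
    refine hconv D n _ (C ^ D) hD hCD (hAKtriv ν) ?_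
    intro M hM
    refine hgainM M ?_ ν
    exact_mod_cast (hL D M).trans hM
  calc ‖coeff ν (∑ u, l u • (f u * G ^ jU u))‖ ≤ C ^ D * A ^ D * R⁻¹ ^ n := hx
    _ = (C * A) ^ D * R⁻¹ ^ n := by rw [mul_pow]

end Summit.Langlands.Langlands.Theorems.HilbertIntegralOverconvergentIsCongruence

end
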